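import Literature.Analysis.FluidPDE.NSCriticalClosureBesovKatoClass
import Literature.Analysis.FluidPDE.NSCriticalClosureBesovBounded
import Literature.Analysis.FluidPDE.TaoLocalisationHolds
import Literature.Analysis.FluidPDE.NSLerayBlowupRateTopHolds
import HarnessLib

/-!
# Crux `TypeIliouvilleNoTypeII` (stmt-NavierStokesRegularity-0056), line `Sketch` (immortal zoom):
  STUB `stub_supNorm` — the sup-norm modulus of a blowing-up Clay solution

Lands `--supports stmt-NavierStokesRegularity-0056` the registered stub `stub_supNorm` of the
lead's skeleton: for a maximal smooth solution `(u, p)` of the unforced Navier–Stokes system on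
`ℝ³ × [0, T)` which is Leray–Hopf from a rapidly decaying datum, the sup-norm modulus
`m(t) := sup_x ‖u(t, x)‖` is

* a genuine (finite) supremum at every `t ∈ [0, T)` — the slices are bounded on every closed slab
  `[0, T₁]`, `T₁ < T` (Tao 2013, `exists_forall_norm_le_of_tao2011` fed by
  `tao2011_hasBoundedSobolevNormsOn_holds`), so `‖u(t, x)‖ ≤ m(t)` and `m(t)` is nearly attained;
* continuous on `[0, T)` — `u ∈ C([0, T₁]; L^∞)` (`continuousInLpOn_top_slab_of_classical`) and,
  the slices being continuous, `|m(t) - m(t₀)| ≤ ‖u(t) - u(t₀)‖_{L^∞}` (a continuous function is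
  bounded *everywhere* by its essential supremum for Lebesgue measure);
* bounded below by Leray's rate `c √ν / √(T - t)` (Leray 1934 §19 (3.9),
  `leray_blowup_rate_top_holds`), whose slab hypothesis `u ∈ L^∞([0, T'] × ℝ³)` is again the Tao
  slab bound.
-/

set_option linter.dupNamespace false

noncomputable section

namespace Summit.NavierStokesRegularity.NavierStokesRegularity.Theorems.TypeIliouvilleNoTypeII.ImmortalZoom

open Set Filter Topology MeasureTheory Function
open scoped ENNReal NNReal
open Literature.Analysis Literature.Analysis.FluidPDE

/-- `ℝ³` (the lead's skeleton states the stub with this local notation; the gate matches the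
header verbatim). -/
local notation "E3" => EuclideanSpace ℝ (Fin 3)

/-- Oscillation of suprema of norms: if `‖f x - g x‖ ≤ D` for every `x` and both families of norms
are bounded above, then `|sup ‖f‖ - sup ‖g‖| ≤ D`. -/
theorem abs_ciSup_norm_sub_ciSup_norm_le {ι F : Type*} [Nonempty ι] [NormedAddCommGroup F]
    {f g : ι → F} (hf : BddAbove (range fun x => ‖f x‖)) (hg : BddAbove (range fun x => ‖g x‖))
    {D : ℝ} (hD : ∀ x, ‖f x - g x‖ ≤ D) :
    |(⨆ x, ‖f x‖) - ⨆ x, ‖g x‖| ≤ D := by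
  rw [abs_sub_le_iff, sub_le_iff_le_add', sub_le_iff_le_add']
  refine ⟨ciSup_le fun x => ?_, ciSup_le fun x => ?_⟩
  · calc ‖f x‖ ≤ ‖g x‖ + ‖f x - g x‖ := norm_le_norm_add_norm_sub' (f x) (g x)
      _ ≤ (⨆ y, ‖g y‖) + D := add_le_add (le_ciSup hg x) (hD x)
  · calc ‖g x‖ ≤ ‖f x‖ + ‖f x - g x‖ := norm_le_norm_add_norm_sub (f x) (g x)
      _ ≤ (⨆ y, ‖f y‖) + D := add_le_add (le_ciSup hf x) (hD x)

/-- An everywhere bound `‖u(t, x)‖ ≤ M` on the closed slab `[0, T'] × ℝ³` bounds the essential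
supremum of `u` on the slab: `‖u‖_{L^∞([0, T'] × ℝ³)} ≤ M < ∞` (no measurability of `u` is needed
for an upper bound on an essential supremum). -/
theorem eLpNorm_uncurry_top_slab_lt_top {u : ℝ → E3 → E3} {T' M : ℝ}
    (hM : ∀ t ∈ Icc 0 T', ∀ x, ‖u t x‖ ≤ M) :
    eLpNorm (uncurry u) ∞ (volume.restrict (Icc 0 T' ×ˢ univ)) < ∞ := by
  refine lt_of_le_of_lt ?_ (ENNReal.ofReal_lt_top (r := M))
  rw [eLpNorm_exponent_top]
  refine eLpNormEssSup_le_of_ae_bound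
    (ae_restrict_of_forall_mem (measurableSet_Icc.prod MeasurableSet.univ) ?_)
  rintro ⟨t, x⟩ ⟨ht, -⟩
  exact hM t ht x

/-- A continuous field on `ℝ³` is bounded **everywhere** by its `L^∞` norm, in real form: if
`‖f‖_{L^∞} < ∞` then `‖f x‖ ≤ ‖f‖_{L^∞}.toReal` for every `x` (Lebesgue measure charges every
nonempty open set; tree lemma `FunctionSpaces.enorm_le_eLpNorm_top_of_continuous`). -/
theorem norm_le_toReal_eLpNorm_top_of_continuous {f : E3 → E3} (hf : Continuous f)
    (hfin : eLpNorm f ∞ volume ≠ ∞) (x : E3) : ‖f x‖ ≤ (eLpNorm f ∞ volume).toReal := by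
  have h := ENNReal.toReal_mono hfin (FunctionSpaces.enorm_le_eLpNorm_top_of_continuous volume hf x)
  rwa [toReal_enorm] at h

/-- **STUB `stub_supNorm`** (the sup-norm modulus of a blowing-up Clay solution). For a maximal
smooth solution on `ℝ³ × [0, T)` which is Leray–Hopf from a rapidly decaying datum,
`m(t) := sup_x ‖u(t, x)‖` is a finite supremum (Tao 2013 slab bounds), continuous on `[0, T)`
(`u ∈ C([0, T₁]; L^∞)` and the pointwise bound of a continuous slice by its essential supremum),
and obeys Leray's lower bound `m(t) ≥ c √ν / √(T - t)`, `c > 0` (Leray 1934 §19 (3.9),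
`leray_blowup_rate_top_holds`). -/
theorem stub_supNorm (ν T : ℝ) (hν : 0 < ν) (hT : 0 < T) (u : ℝ → E3 → E3) (p : ℝ → E3 → ℝ)
    (hmax : IsMaximalSmoothSolution ν 0 u p T) (hLH : IsLerayHopfOn T ν 0 (u 0) u)
    (hdec : HasRapidSpatialDecay (u 0)) :
    ∃ m : ℝ → ℝ, ContinuousOn m (Ico 0 T) ∧ (∀ t ∈ Ico 0 T, ∀ x, ‖u t x‖ ≤ m t) ∧
      (∀ t ∈ Ico 0 T, ∀ ε : ℝ, 0 < ε → ∃ x, m t - ε < ‖u t x‖) ∧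
      ∃ c : ℝ, 0 < c ∧ ∀ t ∈ Ico 0 T, c / Real.sqrt (T - t) ≤ m t := by
  have hsol : IsClassicalNSSolutionOn (Ico 0 T) ν 0 u p := hmax.1
  have hbdd : ∀ T₁ ∈ Ioo 0 T, ∃ M : ℝ, ∀ t ∈ Icc 0 T₁, ∀ x, ‖u t x‖ ≤ M :=
    exists_forall_norm_le_of_tao2011 tao2011_hasBoundedSobolevNormsOn_holds hν hsol hLH hdec
  -- every `t ∈ [0, T)` lies in the closed slab `[0, (t + T)/2]`, `(t + T)/2 ∈ (0, T)`
  have hmid : ∀ t ∈ Ico 0 T, (t + T) / 2 ∈ Ioo 0 T ∧ t < (t + T) / 2 := fun t ht =>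
    ⟨⟨by linarith [ht.1], by linarith [ht.2]⟩, by linarith [ht.2]⟩
  have hBdd : ∀ t ∈ Ico 0 T, BddAbove (range fun x => ‖u t x‖) := by
    intro t ht
    obtain ⟨M, hM⟩ := hbdd _ (hmid t ht).1
    exact ⟨M, by rintro _ ⟨x, rfl⟩; exact hM t ⟨ht.1, (hmid t ht).2.le⟩ x⟩
  -- the modulus `m t := sup_x ‖u t x‖`
  have hle : ∀ t ∈ Ico 0 T, ∀ x, ‖u t x‖ ≤ ⨆ y, ‖u t y‖ := fun t ht x => le_ciSup (hBdd t ht) x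
  have hm0 : ∀ t ∈ Ico 0 T, 0 ≤ ⨆ y, ‖u t y‖ := fun t ht => (norm_nonneg _).trans (hle t ht 0)
  refine ⟨fun t => ⨆ y, ‖u t y‖, fun t₀ ht₀ => ?_, hle, fun t _ ε hε => ?_, ?_⟩
  · -- continuity at `t₀ ∈ [0, T)`: work on the closed slab `[0, T₁]`, `T₁ := (t₀ + T)/2`
    obtain ⟨hT₁, ht₀T₁⟩ := hmid t₀ ht₀
    set T₁ : ℝ := (t₀ + T) / 2 with hT₁_def
    have hcont : ContinuousInLpOn (Icc 0 T₁) ∞ u :=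
      continuousInLpOn_top_slab_of_classical hν hT hsol hLH hdec T₁ hT₁
    have ht₀' : t₀ ∈ Icc 0 T₁ := ⟨ht₀.1, ht₀T₁.le⟩
    have hsub : Icc 0 T₁ ⊆ Ico 0 T := Icc_subset_Ico_right hT₁.2
    -- the modulus of continuity `D t := ‖u t - u t₀‖_{L^∞}`: finite on the slab, `→ 0` at `t₀`
    have hfin : ∀ t ∈ Icc 0 T₁, eLpNorm (u t - u t₀) ∞ volume ≠ ∞ := fun t ht =>
      ((hcont.1 t ht).sub (hcont.1 t₀ ht₀')).eLpNorm_ne_top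
    have hD : Tendsto (fun t => (eLpNorm (u t - u t₀) ∞ volume).toReal) (𝓝[Icc 0 T₁] t₀)
        (𝓝 0) :=
      (ENNReal.tendsto_toReal ENNReal.zero_ne_top).comp (hcont.2 t₀ ht₀')
    -- pointwise: `‖u t x - u t₀ x‖ ≤ D t` for EVERY `x` (continuous slices)
    have hpt : ∀ t ∈ Icc 0 T₁, ∀ x, ‖u t x - u t₀ x‖ ≤ (eLpNorm (u t - u t₀) ∞ volume).toReal :=
      fun t ht x => norm_le_toReal_eLpNorm_top_of_continuous
        ((hsol.contDiff_velocity (hsub ht)).continuous.sub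
          (hsol.contDiff_velocity (hsub ht₀')).continuous) (hfin t ht) x
    have hdist : ∀ t ∈ Icc 0 T₁,
        dist (⨆ y, ‖u t y‖) (⨆ y, ‖u t₀ y‖) ≤ (eLpNorm (u t - u t₀) ∞ volume).toReal := by
      intro t ht
      rw [Real.dist_eq]
      exact abs_ciSup_norm_sub_ciSup_norm_le (hBdd t (hsub ht)) (hBdd t₀ ht₀) (hpt t ht)
    have hcw : ContinuousWithinAt (fun t => ⨆ y, ‖u t y‖) (Icc 0 T₁) t₀ := by
      rw [ContinuousWithinAt, tendsto_iff_dist_tendsto_zero]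
      exact squeeze_zero' (Eventually.of_forall fun t => dist_nonneg)
        (mem_of_superset self_mem_nhdsWithin hdist) hD
    exact hcw.mono_of_mem_nhdsWithin
      (mem_nhdsWithin.2 ⟨Iio T₁, isOpen_Iio, ht₀T₁, fun t ht => ⟨ht.2.1, le_of_lt ht.1⟩⟩)
  · -- near attainment of the supremum
    exact exists_lt_of_lt_ciSup (sub_lt_self _ hε)
  · -- Leray's lower bound `c √ν / √(T - t) ≤ ‖u t‖_{L^∞} ≤ m t`
    obtain ⟨c, hc, hrate⟩ := leray_blowup_rate_top_holds
    have hslab : ∀ T' ∈ Ioo 0 T,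
        eLpNorm (uncurry u) ∞ (volume.restrict (Icc 0 T' ×ˢ univ)) < ∞ := fun T' hT' => by
      obtain ⟨M, hM⟩ := hbdd T' hT'
      exact eLpNorm_uncurry_top_slab_lt_top hM
    refine ⟨c * Real.sqrt ν, mul_pos hc (Real.sqrt_pos.2 hν), fun t ht => ?_⟩
    have h₁ := hrate ν T hν hT u p hmax hLH hslab t ht
    have h₂ : eLpNorm (u t) ∞ volume ≤ ENNReal.ofReal (⨆ y, ‖u t y‖) := by
      rw [eLpNorm_exponent_top]
      exact eLpNormEssSup_le_of_ae_bound (Eventually.of_forall (hle t ht))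
    exact (ENNReal.ofReal_le_ofReal_iff (hm0 t ht)).1 (h₁.trans h₂)

end Summit.NavierStokesRegularity.NavierStokesRegularity.Theorems.TypeIliouvilleNoTypeII.ImmortalZoom

end
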